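import Mathlib.RepresentationTheory.Homological.ContCohomology.Functoriality
import Mathlib.RepresentationTheory.Homological.GroupCohomology.Functoriality
import Mathlib.Topology.Algebra.ContinuousMonoidHom
import Mathlib.Topology.Instances.ZMod
import Mathlib.GroupTheory.Abelianization.Defs
import Mathlib.LinearAlgebra.TensorProduct.Basic
import Mathlib.GroupTheory.QuotientGroup.Basic
import Literature.AlgebraicGeometry.Frobenioids.KummerClass
import HarnessLib

/-!
# Frobenioids II, Definitions 2.2 (ii)(c), 2.3: cohomological saturation, `F_N(A)`, the reciprocity map

Mochizuki, *The geometry of Frobenioids II*, Kyushu J. Math. **62** (2008) 401–460, §2 "The Kummer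
and Reciprocity Maps", Definition 2.2 (ii) pp. 17–18, the discussion pp. 18–19, Definition 2.3
p. 19 [cite: MochizukiFrdII2008, Def 2.2 (ii) p.17].

**Setting of the paper (pp. 16–17).** `C` is a `p`-adic Frobenioid (Ex. 1.1 (ii), `Λ = ℤ`) over
`D = B^temp(Π, Π°)⁰` with its functor to `E = B^temp(G, G°)⁰`, `G ⊆ G_{ℚ_p}` open, `H ⊆ G` a normal
open subgroup, `A ∈ Ob(C)` with `A_D` Galois; `G_A := Aut_C(A)/Ker(Aut_C(A) → Aut_E(A_E))`,
`H_A := Im(H) ⊆ G_A` via the natural surjective outer homomorphism `G ↠ Aut_E(A_E) ≅ G_A`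
(Def. 2.2 (i)); `μ_N(A) ⊆ O^×(A)` is the cyclotomic portion (Def. 2.1 (i), `KummerClass.lean`).

**What this file types (the group-cohomological content, over Mathlib).** Exactly as in
`KummerClass.lean`, the Frobenioid enters only through a group `Γ` (here `= G_A`) acting on the
commutative monoid `O` (`= O^⊳(A)`, or `O^□(A)` of Def. 2.2 (iii)) and a subgroup `H_A ≤ Γ`; the new
datum of Def. 2.2 is the surjection `H ↠ H_A` from the (profinite, in print) group `H`, typed as a
continuous homomorphism `q : H →ₜ* H_A` (`H_A` discrete). Over this:
* Def. 2.2 (ii)(c): the maps `Hⁿ(H_A, −) → Hⁿ(H, −)` induced by `q` (`infl`, Mathlib's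
  `ContinuousCohomology.map`; the cohomology of the profinite `H` in print is continuous cohomology,
  so we use Mathlib's `continuousCohomology` throughout, which for the finite discrete `H_A` is the
  usual one) and the condition "(c)" (`IsCohSaturated`: bijective on `H¹(−, μ_N(A))` and
  `H¹(−, ℤ/Nℤ)`, surjective on `H²(−, μ_N(A))`);
* `F_N(A) := H²(H_A, μ_N(A))/Ker(H²(H_A, μ_N(A)) ↠ H²(H, μ_N(A)))` (`FN`), with the induced
  injection into `H²(H, μ_N(A))` and "so `F_N(A) ≅ H²(H, μ_N(A))`" PROVED under (c)
  (`fnEquivOfSurjective`); the second printed isomorphism "`≅ ℤ/Nℤ` [NSW, Thm 7.2.6]" is local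
  class field theory and is recorded as the property `FNIsCyclic` (not asserted);
* the codomain `H_A^ab ⊗ F_N(A)` of the reciprocity map (`RecTarget`), the isomorphism
  `H¹(H_A, μ_N(A)) ⥲ H_A^ab ⊗ F_N(A)` "induced by the cup product" (p. 18) as an explicit DATUM
  (`DualityIso` — its construction is local Tate duality [NSW, Thm 7.2.6], FOUNDATIONS row 15,
  TODO-merge abc-iut-L4-t4's LCFT facts file), `η_f` (`eta`) and **Definition 2.3**: the Kummer and
  reciprocity maps `O^□(A)^H → H¹(H_A, μ_N(A))`, `O^□(A)^H → H_A^ab ⊗ F_N(A)` (`kummerMapOfRoots`,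
  `reciprocityMap`), the former being `KummerClass.kummerMap` extended to all of `O^□(A)^H` under the
  printed root-existence observation (p. 18, `InvariantsAdmitRoots`).

Deliberately NOT here (companion file `PadicKummerSetting.lean`): Def. 2.2 (i) (`G_A`, `H_A` from the
Frobenioid), (ii)(a)(b), (iii), Remark 2.2.1, Theorem 2.4, Remarks 2.4.1–2.4.2 — they need the
`p`-adic Frobenioid of Ex. 1.1 (ii) and the tempered base categories of Ex. 1.3. Universe: as in
`KummerClass.lean` (Mathlib's multiplicative-cocycle API), all groups and monoids live in `Type`.
-/

namespace Literature.AlgebraicGeometry.Frobenioids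

namespace Kummer

open CategoryTheory groupCohomology
open scoped TensorProduct

variable {Γ : Type} [Group Γ] (N : ℕ) (O : Type) [CommMonoid O] [MulDistribMulAction Γ O]

/-! ### `μ_N(A)` and `ℤ/Nℤ` as discrete topological modules -/

/-- `μ_N(A)` is a finite abstract group in print ("isomorphic to a subgroup of `ℤ/Nℤ`", Def. 2.1 (i)
p. 16); we give it the discrete topology so that it is a coefficient module for continuous
cohomology. [cite: MochizukiFrdII2008, Def 2.1 (i) p.16] -/
instance Mu.instTopologicalSpace : TopologicalSpace (Mu N O) := ⊥

/-- The topology on `μ_N(A)` is discrete. [cite: MochizukiFrdII2008, Def 2.1 (i) p.16] -/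
instance Mu.instDiscreteTopology : DiscreteTopology (Mu N O) := ⟨rfl⟩

variable {N O} in
/-- A `ℤ`-linear representation on a discrete module, regarded as a continuous representation in
Mathlib's sense (each group element acts by a continuous map since the module is discrete). Helper
for the coefficient modules `μ_N(A)`, `ℤ/Nℤ` of Def. 2.2 (ii)(c).
[cite: MochizukiFrdII2008, Def 2.2 (ii) p.17] -/
def discreteContRepOfRep (K M : Type) [Group K] [AddCommGroup M] [TopologicalSpace M]
    [DiscreteTopology M] (ρ : Representation ℤ K M) : ContRepresentation ℤ K M :=
  .ofMonoidHom
    { toFun := fun g => ⟨ρ g, continuous_of_discreteTopology⟩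
      map_one' := by ext x; simp
      map_mul' := fun g h => by ext x; simp }

variable {N O} in
/-- `discreteContRepOfRep` acts by the given representation.
[cite: MochizukiFrdII2008, Def 2.2 (ii) p.17] -/
@[simp] theorem discreteContRepOfRep_apply (K M : Type) [Group K] [AddCommGroup M]
    [TopologicalSpace M] [DiscreteTopology M] (ρ : Representation ℤ K M) (g : K) (x : M) :
    discreteContRepOfRep K M ρ g x = ρ g x := rfl

/-- The coefficient module `μ_N(A)` with its action of a group `K` (in Def. 2.2: `K = H_A`, acting
through `G_A` on `O^⊳(A) ⊇ μ_N(A)`), as a discrete topological `ℤ[K]`-module (on `Additive μ_N(A)`).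
[cite: MochizukiFrdII2008, Def 2.2 (ii) p.17] -/
def muTopRep (K : Type) [Group K] [MulDistribMulAction K (Mu N O)] : TopRep ℤ K :=
  TopRep.of
    (discreteContRepOfRep K (Additive (Mu N O)) (Representation.ofMulDistribMulAction K (Mu N O)))

/-- The coefficient module `ℤ/Nℤ` with the trivial action of `K`, as a discrete topological
`ℤ[K]`-module (the second coefficient module of Def. 2.2 (ii)(c)).
[cite: MochizukiFrdII2008, Def 2.2 (ii) p.17] -/
def trivTopRep (K : Type) [Group K] : TopRep ℤ K :=
  TopRep.of (discreteContRepOfRep K (ZMod N) (Representation.trivial ℤ K (ZMod N)))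

variable (HA : Subgroup Γ)

/-! ### Definition 2.3: the Kummer and reciprocity maps on `O^□(A)^H` -/

/-- The observation of FrdII p. 18 making the Kummer map total on the invariants: "the [first
cohomology module portion of the] Galois-theoretic condition of Definition 2.2, (ii), (c), implies
… that any element `f ∈ O^□(A)^H` admits an `N`-th root `g ∈ O^□(A)` — i.e., `g^N = f`. Thus, the
Kummer map [cf. Definition 2.1, (ii)] is defined on all of `O^□(A)^H`." Typed as the property of the
`H_A`-monoid `O` that every `H_A`-invariant element has an `N`-th root (it is deduced in print from
field theory for the `p`-adic Frobenioid; here it is the hypothesis under which Def. 2.3 is stated).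
[cite: MochizukiFrdII2008, Rmk 2.2.1 p.18] -/
def InvariantsAdmitRoots : Prop := ∀ f : O, (∀ h : HA, (h : Γ) • f = f) → ∃ g : O, g ^ N = f

/-- `O^□(A)^H`: the submonoid of `H_A`-invariant elements of `O` ("the submonoids … of elements on
which `H_A` acts trivially", FrdII p. 18). [cite: MochizukiFrdII2008, Rmk 2.2.1 p.18] -/
def invariantsSubmonoid : Submonoid O where
  carrier := {f | ∀ h : HA, (h : Γ) • f = f}
  mul_mem' ha hb h := by rw [MulDistribMulAction.smul_mul, ha h, hb h]
  one_mem' h := smul_one _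

section
variable {N O HA}

/-- Under `InvariantsAdmitRoots`, `O^□(A)^H` is contained in (indeed equals) the domain
`O^□(A)^{H_A} ∩ O^□(A)^N` of the Kummer map of Def. 2.1 (ii).
[cite: MochizukiFrdII2008, Rmk 2.2.1 p.18] -/
theorem invariantsSubmonoid_le_kummerDomain (hR : InvariantsAdmitRoots N O HA) :
    invariantsSubmonoid O HA ≤ kummerDomain N O HA := fun f hf => ⟨hf, hR f hf⟩

/-- Conversely the domain of the Kummer map consists of invariants.
[cite: MochizukiFrdII2008, Rmk 2.2.1 p.18] -/
theorem kummerDomain_le_invariantsSubmonoid : kummerDomain N O HA ≤ invariantsSubmonoid O HA :=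
  fun _ hf => hf.1

/-- **Definition 2.3** (FrdII p. 19), the *Kummer map* `O^□(A)^H → H¹(H_A, μ_N(A))`, `f ↦ κ_f`
"[associated to the `(N,H)`-saturated object `A`]": the Kummer map of Def. 2.1 (ii)
(`Kummer.kummerMap`) on all of `O^□(A)^H`, every invariant admitting an `N`-th root (p. 18).
[cite: MochizukiFrdII2008, Def 2.3 p.19] -/
noncomputable def kummerMapOfRoots [IsCancelMul O] (hO : NthRootsDifferByUnits N O)
    (hR : InvariantsAdmitRoots N O HA) :
    invariantsSubmonoid O HA →* Multiplicative (H1 (Rep.ofMulDistribMulAction HA (Mu N O))) :=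
  (kummerMap hO HA).comp (Submonoid.inclusion (invariantsSubmonoid_le_kummerDomain hR))

/-- The Kummer map of Def. 2.3 on `f` is the Kummer class `κ_f` of Def. 2.1 (ii).
[cite: MochizukiFrdII2008, Def 2.3 p.19] -/
theorem kummerMapOfRoots_apply [IsCancelMul O] (hO : NthRootsDifferByUnits N O)
    (hR : InvariantsAdmitRoots N O HA) (f : invariantsSubmonoid O HA) :
    kummerMapOfRoots hO hR f =
      Multiplicative.ofAdd (kummerClass hO HA ⟨f, invariantsSubmonoid_le_kummerDomain hR f.2⟩) :=
  rfl

end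

/-! ### The maps `Hⁿ(H_A, −) → Hⁿ(H, −)` induced by `H ↠ H_A` (Def. 2.2 (ii)(c)) -/

variable [TopologicalSpace Γ] [DiscreteTopology Γ]
variable {H : Type} [Group H] [TopologicalSpace H] [IsTopologicalGroup H] (q : H →ₜ* HA)

variable {N O} in
/-- For a coefficient module `X` of `H_A` (discrete group; in print `H_A ⊆ G_A` is finite), the map
`Hⁿ(H_A, X) → Hⁿ(H, X)` on continuous cohomology induced by the continuous homomorphism
`q : H → H_A` (in Def. 2.2 the natural surjection `H ↠ H_A`), `H` acting on `X` through `q`: "the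
natural surjective homomorphism `H ↠ H_A` induces [maps] on first cohomology modules … on second
cohomology modules" (FrdII Def. 2.2 (ii)(c), p. 17). [cite: MochizukiFrdII2008, Def 2.2 (ii) p.17] -/
noncomputable def infl (X : TopRep ℤ HA) (n : ℕ) :
    continuousCohomology n X ⟶ continuousCohomology n (TopRep.res (q : H →* HA) X) :=
  ContinuousCohomology.map q (𝟙 _) n

/-- **Definition 2.2 (ii)(c)** (FrdII p. 17), the cohomological condition on `H ↠ H_A`: it "induces
isomorphisms on first cohomology modules `H¹(H_A, μ_N(A)) ⥲ H¹(H, μ_N(A))`,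
`H¹(H_A, ℤ/Nℤ) ⥲ H¹(H, ℤ/Nℤ)` and a surjection on second cohomology modules
`H²(H_A, μ_N(A)) ↠ H²(H, μ_N(A))`". (Conditions (a) "`A` is `μ_N`-saturated" = `IsMuSaturated` and
(b) "`A_D` is Galois" are assembled with (c) in `PadicKummerSetting.lean`.)
[cite: MochizukiFrdII2008, Def 2.2 (ii)(c) p.17] -/
@[mk_iff] structure IsCohSaturated : Prop where
  /-- `H¹(H_A, μ_N(A)) ⥲ H¹(H, μ_N(A))` -/
  bijective_one_mu : Function.Bijective (infl HA q (muTopRep N O HA) 1).hom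
  /-- `H¹(H_A, ℤ/Nℤ) ⥲ H¹(H, ℤ/Nℤ)` -/
  bijective_one_triv : Function.Bijective (infl HA q (trivTopRep N HA) 1).hom
  /-- `H²(H_A, μ_N(A)) ↠ H²(H, μ_N(A))` -/
  surjective_two_mu : Function.Surjective (infl HA q (muTopRep N O HA) 2).hom

/-! ### `F_N(A)` (Def. 2.2 (ii)) -/

/-- The map `H²(H_A, μ_N(A)) → H²(H, μ_N(A))` of condition (c) as a homomorphism of abelian groups.
[cite: MochizukiFrdII2008, Def 2.2 (ii) p.17] -/
noncomputable def inflTwo :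
    continuousCohomology 2 (muTopRep N O HA) →+
      continuousCohomology 2 (TopRep.res (q : H →* HA) (muTopRep N O HA)) :=
  (infl HA q (muTopRep N O HA) 2).hom.toLinearMap.toAddMonoidHom

/-- `inflTwo` is the map of condition (c) on elements. [cite: MochizukiFrdII2008, Def 2.2 (ii) p.17] -/
@[simp] theorem inflTwo_apply (x : continuousCohomology 2 (muTopRep N O HA)) :
    inflTwo N O HA q x = (infl HA q (muTopRep N O HA) 2).hom x := rfl

/-- `Ker(H²(H_A, μ_N(A)) → H²(H, μ_N(A)))`, the subgroup divided out in the definition of `F_N(A)`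
(FrdII Def. 2.2 (ii), p. 17). [cite: MochizukiFrdII2008, Def 2.2 (ii) p.17] -/
noncomputable def fnKer : AddSubgroup (continuousCohomology 2 (muTopRep N O HA)) :=
  (inflTwo N O HA q).ker

/-- **Definition 2.2 (ii)** (FrdII pp. 17–18):
`F_N(A) := H²(H_A, μ_N(A)) / Ker(H²(H_A, μ_N(A)) ↠ H²(H, μ_N(A)))` (an abelian group).
[cite: MochizukiFrdII2008, Def 2.2 (ii) p.17] -/
abbrev FN : Type := (continuousCohomology 2 (muTopRep N O HA)) ⧸ fnKer N O HA q

/-- The injection `F_N(A) ↪ H²(H, μ_N(A))` induced by `H²(H_A, μ_N(A)) → H²(H, μ_N(A))` on the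
quotient by its kernel (FrdII Def. 2.2 (ii), p. 18: "so `F_N(A) ≅ H²(H, μ_N(A))`" under (c)).
[cite: MochizukiFrdII2008, Def 2.2 (ii) p.18] -/
noncomputable def fnToH2 :
    FN N O HA q →+ continuousCohomology 2 (TopRep.res (q : H →* HA) (muTopRep N O HA)) :=
  QuotientAddGroup.kerLift (inflTwo N O HA q)

/-- `F_N(A) → H²(H, μ_N(A))` is injective (first isomorphism theorem).
[cite: MochizukiFrdII2008, Def 2.2 (ii) p.18] -/
theorem fnToH2_injective : Function.Injective (fnToH2 N O HA q) :=
  QuotientAddGroup.kerLift_injective (inflTwo N O HA q)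

/-- `fnToH2` on the class of `x ∈ H²(H_A, μ_N(A))` is the image of `x` in `H²(H, μ_N(A))`.
[cite: MochizukiFrdII2008, Def 2.2 (ii) p.18] -/
theorem fnToH2_mk (x : continuousCohomology 2 (muTopRep N O HA)) :
    fnToH2 N O HA q (x : FN N O HA q) = (infl HA q (muTopRep N O HA) 2).hom x :=
  QuotientAddGroup.kerLift_mk (inflTwo N O HA q) x

/-- "so `F_N(A) ≅ H²(H, μ_N(A))`" (FrdII Def. 2.2 (ii), p. 18): under the surjectivity clause of
condition (c), `F_N(A)` maps isomorphically onto `H²(H, μ_N(A))`.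
[cite: MochizukiFrdII2008, Def 2.2 (ii) p.18] -/
noncomputable def fnEquivOfSurjective
    (h : Function.Surjective (infl HA q (muTopRep N O HA) 2).hom) :
    FN N O HA q ≃+ continuousCohomology 2 (TopRep.res (q : H →* HA) (muTopRep N O HA)) :=
  QuotientAddGroup.quotientKerEquivOfSurjective (inflTwo N O HA q) h

/-- The printed isomorphism "`F_N(A) ≅ H²(H, μ_N(A)) ≅ ℤ/Nℤ` [cf., e.g., [NSW], Chapter 7, Theorem
7.2.6]" (FrdII p. 18), second half, as a PROPERTY of the data (it holds in the paper's setting by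
local class field theory — the Brauer group of a `p`-adic field; not asserted here).
[cite: MochizukiFrdII2008, Def 2.2 (ii) p.18] -/
def FNIsCyclic : Prop := Nonempty (FN N O HA q ≃+ ZMod N)

/-! ### The reciprocity target `H_A^ab ⊗ F_N(A)`, the duality isomorphism, `η_f` (p. 18) -/

/-- The codomain `H_A^ab ⊗ F_N(A)` of the reciprocity map (FrdII p. 18 and Def. 2.3, p. 19):
the abelianization of `H_A` (written additively) tensored over `ℤ` with `F_N(A)`.
[cite: MochizukiFrdII2008, Def 2.3 p.19] -/
abbrev RecTarget : Type := Additive (Abelianization HA) ⊗[ℤ] FN N O HA q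

/-- The isomorphism "`H¹(H_A, μ_N(A)) ⥲ H_A^ab ⊗ F_N(A)` [induced by the cup product on group
cohomology]" of FrdII p. 18, obtained there from "the well-known duality theory of nonarchimedean
[mixed-characteristic] local fields [cf., e.g., [NSW], Chapter 7, Theorem 7.2.6]: the cup product …
determines an isomorphism `H¹(H, μ_N(A)) ⥲ H^ab ⊗ H²(H, μ_N(A))`" together with condition (c) of
Def. 2.2 (ii). Its construction is local class field theory (local Tate duality), outside the scope
of [FrdII]; it is therefore carried as an explicit DATUM (TODO-merge: abc-iut-L4-t4's LCFT facts
file, FOUNDATIONS row 15). The domain is the first cohomology group of the (finite, in print) group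
`H_A` in which the Kummer classes of `KummerClass.lean` live. The printed properties "independent of
the choice of the homomorphism `H ↠ H_A` among its various `G`-conjugates" and "compatible with the
natural actions of `G_A/H_A`" are recorded with the Frobenioid-level setting
(`PadicKummerSetting.lean`). [cite: MochizukiFrdII2008, Def 2.2 p.18] -/
structure DualityIso where
  /-- the isomorphism `H¹(H_A, μ_N(A)) ⥲ H_A^ab ⊗ F_N(A)` -/
  toAddEquiv : H1 (Rep.ofMulDistribMulAction HA (Mu N O)) ≃+ RecTarget N O HA q

variable {N O HA q}

/-- "Write `η_f ∈ H_A^ab ⊗ F_N(A)` for the image of `κ_f` via this last isomorphism" (FrdII p. 18):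
`η_f` for `f` in the domain of the Kummer map, any `N`-th root giving the same class.
[cite: MochizukiFrdII2008, Def 2.2 p.18] -/
noncomputable def eta [IsCancelMul O] (hO : NthRootsDifferByUnits N O) (ι : DualityIso N O HA q)
    (f : kummerDomain N O HA) : RecTarget N O HA q :=
  ι.toAddEquiv (kummerClass hO HA f)

/-! ### Definition 2.3, continued: the reciprocity map -/

/-- **Definition 2.3** (FrdII p. 19), the *reciprocity map* `O^□(A)^H → H_A^ab ⊗ F_N(A)`,
`f ↦ η_f`: the Kummer map followed by the duality isomorphism `H¹(H_A, μ_N(A)) ⥲ H_A^ab ⊗ F_N(A)`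
of p. 18. [cite: MochizukiFrdII2008, Def 2.3 p.19] -/
noncomputable def reciprocityMap [IsCancelMul O] (hO : NthRootsDifferByUnits N O)
    (hR : InvariantsAdmitRoots N O HA) (ι : DualityIso N O HA q) :
    invariantsSubmonoid O HA →* Multiplicative (RecTarget N O HA q) :=
  (AddMonoidHom.toMultiplicative ι.toAddEquiv.toAddMonoidHom).comp (kummerMapOfRoots hO hR)

/-- The reciprocity map sends `f` to `η_f` (FrdII p. 18 / Def. 2.3 p. 19).
[cite: MochizukiFrdII2008, Def 2.3 p.19] -/
theorem reciprocityMap_apply [IsCancelMul O] (hO : NthRootsDifferByUnits N O)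
    (hR : InvariantsAdmitRoots N O HA) (ι : DualityIso N O HA q) (f : invariantsSubmonoid O HA) :
    reciprocityMap hO hR ι f =
      Multiplicative.ofAdd (eta hO ι ⟨f, invariantsSubmonoid_le_kummerDomain hR f.2⟩) :=
  rfl

end Kummer

end Literature.AlgebraicGeometry.Frobenioids
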